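import Literature.Probability.RandomPlanarGeometry.SLEStoppedArcLaws
import Literature.Probability.RandomPlanarGeometry.ChordalWindowSegments
import Literature.Probability.RandomPlanarGeometry.ConformalRectangleProofs
import Literature.Probability.RandomPlanarGeometry.ConformalMapCaratheodoryProofs
import Literature.Probability.RandomPlanarGeometry.MarkedDomainCorners
import Literature.Probability.RandomPlanarGeometry.SameSideHypergeometric
import Literature.Probability.RandomPlanarGeometry.SwallowingProbCalculus
import Literature.Probability.RandomPlanarGeometry.ChordalCurveFamily
import HarnessLib

/-!
# Target independence pins `κ = 6` among the families of chordal SLE_κ laws (`κ > 4`)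

Topic `Probability/RandomPlanarGeometry`; theorems only. Lawler–Schramm–Werner (2001), §3 /
Werner (2007), Prop. 3.4: among the SLE_κ only SLE₆ has the locality property. Here in the
*splitting form* `ChordalFamily.IsTargetIndependent` (LSW Cor. 2.3): in a three-marked domain
`(D; p₀, p₁, p₂)` the curve to `p₁` and the curve to `p₂`, stopped on `[p₁, p₂]`, have the same law.

* `eq_one_third_of_swallowingIntegral_eq_sameSideH` — **the special-function core**: an affine
  relation `c₁ ∫₀ʳ u^{-2a}(1-u)^{-2a} du = c₂ h((1-r)⁻¹) + d` (`c₁ > 0`) between Lawler's two-sided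
  primitive (`swallowingIntegral a`, Prop. 6.33) and Rohde–Schramm's same-side primitive
  `h = sameSideH a` (Lemma 6.6) on an interval forces `a = 1/3`;
* `swallowingProb_eq_of_isTargetIndependent` — for a family of chordal SLE_κ laws (`κ > 4`),
  target independence tested on the events "the stopped curve has met the sub-arc
  `[boundary t, p₁]`", `t ∈ (mark 0, mark 1)` (Borel by
  `CurveClass.measurableSet_stopAt_preimage_hitsBefore_empty`), yields
  `Ψ_{2/κ}(1 - η) = 1 - P[T_{|g t|} = T_{|b|}]` with `η = g t / b ∈ (0, 1)` the cross-ratio of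
  `(p₀, boundary t, p₁, p₂)` (`g` the pulled-back parametrisation of the chordal map towards `p₂`,
  `b = g (mark 1)`): the curve to `p₁` contributes Lawler's two-sided law
  (`measureReal_preimage_stopAt_hitsBefore_of_rays`, rays from
  `ConformalRectangle.exists_rays_of_isChordalUniformizing_of_disc`), the curve to `p₂` the
  same-side law (`measureReal_preimage_stopAt_hitsBefore_of_segment`, segment from
  `ConformalRectangle.boundaryExtension_mem_image_Icc_iff_uIcc`), and the two cross-ratio readings
  agree by `ConformalRectangle.crossRatio_eq_of_isUniformizing_holds`;
* `eq_six_of_isSLELaw_of_isTargetIndependent_of_four_lt` — hence `κ = 6`: `η` sweeps `(0, 1)`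
  (intermediate value theorem), for `κ ≥ 8` the right-hand side is `1 > Ψ`, and for `4 < κ < 8`
  the affine relation between the two primitives forces `2/κ = 1/3`.

The phase `κ ≤ 4` (simple curves are never target independent) is Summit-side
(`Summits/CriticalPhenomena/CardyFormulaZ2/Theorems/CardyRotToConfR2SymmetryUpgrade/Negative/TargetIndependence.lean`).
References: G. F. Lawler, O. Schramm, W. Werner, Acta Math. 187 (2001), §3; W. Werner, *Lectures on
two-dimensional critical percolation* (2007), Prop. 3.4; S. Rohde, O. Schramm, Ann. of Math. 161
(2005), Lemma 6.6, Cor. 7.4; G. F. Lawler (2005), Prop. 6.33, Prop. 6.34.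
-/

noncomputable section

open Set Filter Topology MeasureTheory Complex Metric
open UpperHalfPlane (upperHalfPlaneSet)
open scoped NNReal ENNReal unitInterval

namespace Literature.Probability.RandomPlanarGeometry

/-! ### The special-function core: the two-sided/same-side identity forces `a = 1/3` -/

/-- **The special-function core of "target independence pins `κ = 6`" (`4 < κ < 8`).** If
Lawler's two-sided crossing primitive `∫₀ʳ u^{-2a}(1-u)^{-2a}` (`swallowingIntegral a`, Lawler
(2005), Prop. 6.33) and Rohde–Schramm's same-side primitive read at `1/(1-r)`
(`sameSideH a (1-r)⁻¹`, Lemma 6.6) are affinely related, `c₁ ∫₀ʳ K = c₂ h(1/(1-r)) + d` with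
`c₁ > 0`, on a non-trivial sub-interval of `(0, 1)`, then `a = 1/3`. Differentiating
(`hasDerivAt_swallowingIntegral`, `sameSideKernel_inv_one_sub`):
`c₁ r^{-2a}(1-r)^{-2a} = c₂ r^{-2a}(1-r)^{4a-2}`, so `(1-r)^{2-6a}` is constant, forcing
`2 - 6a = 0`. [cite: LawlerSchrammWerner2001, §3] -/
theorem eq_one_third_of_swallowingIntegral_eq_sameSideH {a c₁ c₂ d r₁ r₂ : ℝ} (ha : a < 1 / 2)
    (hr₁ : 0 ≤ r₁) (hr₁₂ : r₁ < r₂) (hr₂ : r₂ ≤ 1) (hc₁ : 0 < c₁)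
    (h : ∀ r ∈ Ioo r₁ r₂, c₁ * swallowingIntegral a r = c₂ * sameSideH a (1 - r)⁻¹ + d) :
    a = 1 / 3 := by
  -- proof by the wave-1 worker S3 (work/stubs/stub_typedSchrammLSWLocalityPinsSix.lean)
  -- `(1 - r)^{2 - 6a} = c₂/c₁` on the interval
  have key : ∀ r ∈ Ioo r₁ r₂, (1 - r) ^ (2 - 6 * a) = c₂ / c₁ := by
    intro r hr
    have hr01 : r ∈ Ioo (0 : ℝ) 1 := ⟨lt_of_le_of_lt hr₁ hr.1, lt_of_lt_of_le hr.2 hr₂⟩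
    have h1r : 0 < 1 - r := by linarith [hr01.2]
    have hι : 1 < (1 - r)⁻¹ := by
      rw [← one_div, lt_div_iff₀ h1r]
      linarith [hr01.1]
    have hL : HasDerivAt (fun r : ℝ => c₁ * swallowingIntegral a r) (c₁ * swallowingKernel a r) r :=
      (hasDerivAt_swallowingIntegral ha hr01).const_mul c₁
    have hR : HasDerivAt (fun r : ℝ => c₂ * sameSideH a (1 - r)⁻¹ + d)
        (c₂ * (sameSideKernel a (1 - r)⁻¹ * ((1 - r) ^ 2)⁻¹)) r :=
      ((HasDerivAt.comp r (h₂ := sameSideH a) (hasDerivAt_sameSideH a hι)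
        (hasDerivAt_inv_one_sub hr01.2.ne)).const_mul c₂).add_const d
    have hLR : HasDerivAt (fun r : ℝ => c₁ * swallowingIntegral a r)
        (c₂ * (sameSideKernel a (1 - r)⁻¹ * ((1 - r) ^ 2)⁻¹)) r :=
      hR.congr_of_eventuallyEq
        (Filter.eventually_of_mem (Ioo_mem_nhds hr.1 hr.2) fun w hw => h w hw)
    have heq : c₁ * swallowingKernel a r = c₂ * (sameSideKernel a (1 - r)⁻¹ * ((1 - r) ^ 2)⁻¹) :=
      hL.unique hLR
    rw [mul_comm (sameSideKernel a _) _, sameSideKernel_inv_one_sub a hr01, swallowingKernel,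
      show (1 - 2 * a - 1 : ℝ) = -(2 * a) by ring] at heq
    have hrpow : (r ^ (-(2 * a)) : ℝ) ≠ 0 := (Real.rpow_pos_of_pos hr01.1 _).ne'
    have h3 : c₁ * (1 - r) ^ (-(2 * a)) = c₂ * (1 - r) ^ (-(2 - 4 * a)) := by
      refine mul_left_cancel₀ hrpow ?_
      calc r ^ (-(2 * a)) * (c₁ * (1 - r) ^ (-(2 * a)))
          = c₁ * (r ^ (-(2 * a)) * (1 - r) ^ (-(2 * a))) := by ring
        _ = c₂ * (r ^ (-(2 * a)) * (1 - r) ^ (-(2 - 4 * a))) := heq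
        _ = r ^ (-(2 * a)) * (c₂ * (1 - r) ^ (-(2 - 4 * a))) := by ring
    have hY : ((1 - r) ^ (-(2 - 4 * a)) : ℝ) ≠ 0 := (Real.rpow_pos_of_pos h1r _).ne'
    rw [show (2 - 6 * a : ℝ) = -(2 * a) - -(2 - 4 * a) by ring, Real.rpow_sub h1r,
      div_eq_div_iff hY hc₁.ne']
    calc (1 - r) ^ (-(2 * a)) * c₁ = c₁ * (1 - r) ^ (-(2 * a)) := mul_comm _ _
      _ = c₂ * (1 - r) ^ (-(2 - 4 * a)) := h3
  -- two distinct points of the interval have the same power, so the exponent vanishes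
  by_contra ha3
  have he : (2 - 6 * a : ℝ) ≠ 0 := fun he => ha3 (by linarith)
  set m₁ : ℝ := (2 * r₁ + r₂) / 3 with hm₁
  set m₂ : ℝ := (r₁ + 2 * r₂) / 3 with hm₂
  have k₁ := key m₁ ⟨by linarith, by linarith⟩
  have k₂ := key m₂ ⟨by linarith, by linarith⟩
  have hinj := Real.rpow_left_injOn he (x := 2 - 6 * a)
  have h12 : (1 - m₁ : ℝ) = 1 - m₂ :=
    hinj (show (1 - m₁ : ℝ) ∈ {y : ℝ | 0 ≤ y} from Set.mem_setOf_eq ▸ (by linarith))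
      (show (1 - m₂ : ℝ) ∈ {y : ℝ | 0 ≤ y} from Set.mem_setOf_eq ▸ (by linarith)) (k₁.trans k₂.symm)
  have : m₁ = m₂ := by linarith
  rw [hm₁, hm₂] at this
  linarith

/-! ### Target independence of a family of SLE_κ laws in a three-marked domain -/

section Assembly

open Literature.Probability.Process

variable {κ : ℝ≥0} {Q : ChordalFamily}

/-- **The two stopped-curve laws of a target-independent family of SLE_κ laws (`κ > 4`) in a
three-marked domain `(D; p₀, p₁, p₂)`.** Let `ψ₂` be the chordal map of the law towards `p₂`, `g`
the pulled-back boundary parametrisation and `b = g (mark 1)` the preimage of `p₁`. For every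
`t ∈ (mark 0, mark 1)` target independence, tested on the event "the curve stopped on `[p₁, p₂]`
has met the sub-arc `[boundary t, p₁]`", gives
`Ψ_{2/κ}(1 - g t / b) = 1 - P[T_{|g t|} = T_{|b|}]` (Lawler's two-sided law for the curve to
`p₁`, read through the cross-ratio of `(p₀, boundary t, p₁, p₂)`; the same-side event for the
curve to `p₂`), where `g t / b ∈ (0, 1)`. [cite: LawlerSchrammWerner2001, §3] -/
theorem swallowingProb_eq_of_isTargetIndependent (hκ : 4 < κ)
    (hQ : ∀ D : DobrushinDomain, IsSLELaw κ D (Q D)) (hT : Q.IsTargetIndependent)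
    (D : MarkedDomain 3) :
    ∃ (g : ℝ → ℝ) (b : ℝ), b ≠ 0 ∧ ContinuousOn g (Icc (D.mark 0) (D.mark 1)) ∧ g (D.mark 0) = 0 ∧
      g (D.mark 1) = b ∧ ∀ t ∈ Ioo (D.mark 0) (D.mark 1), g t / b ∈ Ioo (0 : ℝ) 1 ∧
        swallowingProb (2 / (κ : ℝ)) (1 - g t / b) =
          1 - preWienerMeasure.real {ω |
            Loewner.swallowingTime (sleDriving κ ω) ((|g t| : ℝ) : ℂ) =
              Loewner.swallowingTime (sleDriving κ ω) ((|b| : ℝ) : ℂ)} := by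
  have hC := JordanDomain.exists_continuousOn_extension_holds
  obtain ⟨Γ₁, ⟨hΓ₁m, ψ₁, hψ₁, hae₁⟩, hQ₁⟩ := hQ (D.chord 0 1 (by decide))
  obtain ⟨Γ₂, ⟨hΓ₂m, ψ₂, hψ₂, hae₂⟩, hQ₂⟩ := hQ (D.chord 0 2 (by decide))
  have hTr : HasSLETrace κ := hae₂.mono fun ω hω ↦ ⟨_, hω.1⟩
  -- the rectangle `R' = (D; p₀, p₁, p₂, q)`, `q = boundary ((mark 2 + 1)/2)`, carries the window
  -- bookkeeping of `ψ₂`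
  have h01 : D.mark 0 < D.mark 1 := D.strictMono_mark (by decide)
  have h12 : D.mark 1 < D.mark 2 := D.strictMono_mark (by decide)
  have hm0 := (D.mark_mem 0).1
  have hm2 := (D.mark_mem 2).2
  let R' : ConformalRectangle :=
    { toJordanDomain := D.toJordanDomain
      mark := ![D.mark 0, D.mark 1, D.mark 2, (D.mark 2 + 1) / 2]
      strictMono_mark := Fin.strictMono_iff_lt_succ.2 fun i ↦ by
        fin_cases i
        · exact h01
        · exact h12
        · show D.mark 2 < (D.mark 2 + 1) / 2
          linarith
      mark_mem := fun i ↦ by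
        fin_cases i
        · exact D.mark_mem 0
        · exact D.mark_mem 1
        · exact D.mark_mem 2
        · show (D.mark 2 + 1) / 2 ∈ Ico (0 : ℝ) 1
          exact ⟨by linarith, by linarith⟩ }
  have hR'arc : R'.arc 1 = D.arc 1 := by
    rw [ConformalRectangle.arc_one_eq, MarkedDomain.arc_one_three]
    rfl
  have h₀₂ : ψ₂.HasBoundaryValue 0 (R'.pt 0) := hψ₂.1
  have h₂₂ : ψ₂.HasBoundaryValueAtInfty (R'.pt 2) := hψ₂.2
  obtain ⟨Φ₂, hΦ₂⟩ := JordanDomain.exists_isDiscExtension (D := R'.toJordanDomain) hC ψ₂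
  set g := JordanDomain.discParam R'.toJordanDomain Φ₂ with hg
  have hg0 : g (D.mark 0) = 0 := ConformalRectangle.discParam_mark_zero hΦ₂ h₀₂
  have hb0 : g (D.mark 1) ≠ 0 := by
    rcases ConformalRectangle.discParam_signs hΦ₂ h₂₂ h₀₂ with ⟨-, h⟩ | ⟨h, -⟩
    · exact h.ne'
    · exact h.ne
  have hrayF : ∀ z : ℂ, 0 ≤ z.im → (ψ₂.boundaryExtension z ∈ D.arc 1 ↔ z ∈ realRay (g (D.mark 1))) :=
    fun z hz ↦ by
      rw [← hR'arc]
      exact (ConformalRectangle.boundaryExtension_mem_arc_iff hΦ₂ h₂₂ h₀₂ hz).1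
  refine ⟨g, g (D.mark 1), hb0, ?_, hg0, rfl, fun t ht ↦ ?_⟩
  · refine (ConformalRectangle.continuousOn_discParam_Ioo hΦ₂ h₂₂).mono fun s hs ↦ ?_
    exact ⟨R'.mark_zero_mem_Ioo.1.trans_le hs.1, hs.2.trans_lt R'.mark_one_mem_Ioo.2⟩
  -- the rectangle `R_t = (D; p₀, boundary t, p₁, p₂)`
  let Rt : ConformalRectangle :=
    { toJordanDomain := D.toJordanDomain
      mark := ![D.mark 0, t, D.mark 1, D.mark 2]
      strictMono_mark := Fin.strictMono_iff_lt_succ.2 fun i ↦ by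
        fin_cases i
        · exact ht.1
        · exact ht.2
        · exact h12
      mark_mem := fun i ↦ by
        fin_cases i
        · exact D.mark_mem 0
        · exact ⟨hm0.trans ht.1.le, ht.2.trans (D.mark_mem 1).2⟩
        · exact D.mark_mem 1
        · exact D.mark_mem 2 }
  have hRtarc1 : Rt.arc 1 = D.boundary '' Icc t (D.mark 1) := ConformalRectangle.arc_one_eq _
  have hRtarc2 : Rt.arc 2 = D.arc 1 := by
    rw [ConformalRectangle.arc_two_eq, MarkedDomain.arc_one_three]
    rfl
  have htW : t ∈ Ioo (R'.mark 2 - 1) (R'.mark 2) :=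
    ⟨R'.mark_zero_mem_Ioo.1.trans ht.1, ht.2.trans R'.mark_one_mem_Ioo.2⟩
  have hord : 0 < g t ∧ g t < g (D.mark 1) ∨ g (D.mark 1) < g t ∧ g t < 0 :=
    ConformalRectangle.discParam_order_of_mem_Ioo hΦ₂ h₂₂ h₀₂ ht
  have hsegA : ∀ z : ℂ, 0 ≤ z.im →
      (ψ₂.boundaryExtension z ∈ Rt.arc 1 ↔ z.im = 0 ∧ z.re ∈ uIcc (g t) (g (D.mark 1))) :=
    fun z hz ↦ by
    rw [hRtarc1]
    exact ConformalRectangle.boundaryExtension_mem_image_Icc_iff_uIcc hΦ₂ h₂₂ htW.1 ht.2.le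
      R'.mark_one_mem_Ioo.2 hz
  have hbA : (D.chord 0 2 (by decide)).pt 1 ∉ Rt.arc 1 := by
    rw [MarkedDomain.pt_chord_one, show D.pt 2 = Rt.pt 3 from rfl, Rt.pt_mem_arc_iff]
    decide
  -- the event and its measurability
  set E : Set (CurveClass ℂ) := CurveClass.stopAt (D.arc 1) ⁻¹' CurveClass.hitsBefore (Rt.arc 1) ∅
    with hE
  have hEm : MeasurableSet E :=
    CurveClass.measurableSet_stopAt_preimage_hitsBefore_empty (Rt.isClosed_arc 1) (D.isClosed_arc 1)
  -- config 2: the curve towards `p₂`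
  have hP2 := measureReal_preimage_stopAt_hitsBefore_of_segment hκ hTr hae₂ (D.isClosed_arc 1) hbA
    hord hsegA hrayF
  -- config 1: the curve towards `p₁`
  obtain ⟨u, v, huv, harc1, harc2, hcr⟩ :=
    ConformalRectangle.exists_rays_of_isChordalUniformizing_of_disc hC Rt hψ₁
  have hP1 := measureReal_preimage_stopAt_hitsBefore_of_rays hκ hae₁ (D.isClosed_arc 1) huv harc1
    (fun z hz ↦ by rw [← hRtarc2]; exact harc2 z hz)
  -- target independence
  have hTI := hT D _ (CurveClass.isClosed_hitsBefore_empty_right (Rt.isClosed_arc 1)).measurableSet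
  rw [hQ₁, hQ₂, Measure.map_apply_of_aemeasurable hΓ₁m hEm,
    Measure.map_apply_of_aemeasurable hΓ₂m hEm] at hTI
  have hTI' := congrArg ENNReal.toReal hTI
  rw [← measureReal_def, ← measureReal_def, hP1, hP2] at hTI'
  -- the cross-ratio of `R_t` from both sides
  have hv₁ : ψ₂.HasBoundaryValue (g t) (Rt.pt 1) :=
    ConformalRectangle.hasBoundaryValue_discParam_of_mem_Ioo hΦ₂ h₂₂ htW
  have hv₂ : ψ₂.HasBoundaryValue (g (D.mark 1)) (Rt.pt 2) :=
    ConformalRectangle.hasBoundaryValue_discParam_mark_one hΦ₂ h₂₂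
  obtain ⟨φ₀, x₀, hφ₀, hcr₀⟩ :=
    ConformalRectangle.exists_isUniformizing_crossRatio_eq_div (R := Rt) ψ₂ hψ₂.1 hv₁ hv₂ hψ₂.2 hord
  have hη : |v| / (|u| + |v|) = g t / g (D.mark 1) := (hcr φ₀ x₀ hφ₀).symm.trans hcr₀
  have huv0 : 0 < |u| + |v| := by
    rcases huv with ⟨hu, hv⟩ | ⟨hv, hu⟩
    · exact add_pos (abs_pos.2 hu.ne) (abs_pos.2 hv.ne')
    · exact add_pos (abs_pos.2 hu.ne') (abs_pos.2 hv.ne)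
  have hη' : |u| / (|u| + |v|) = 1 - g t / g (D.mark 1) := by
    rw [← hη]
    field_simp
    ring
  refine ⟨?_, ?_⟩
  · rw [← hη]
    rcases huv with ⟨hu, hv⟩ | ⟨hv, hu⟩
    · exact ⟨div_pos (abs_pos.2 hv.ne') huv0, (div_lt_one huv0).2 (by linarith [abs_pos.2 hu.ne])⟩
    · exact ⟨div_pos (abs_pos.2 hv.ne) huv0, (div_lt_one huv0).2 (by linarith [abs_pos.2 hu.ne'])⟩
  · rw [← hη', ← hTI']

/-- **For `κ > 4`, a target-independent family of chordal SLE_κ laws has `κ = 6`**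
(Lawler–Schramm–Werner (2001), §3: among the SLE_κ only SLE₆ has the locality property, here in
its splitting form `ChordalFamily.IsTargetIndependent`, LSW Cor. 2.3). In a three-marked domain,
`swallowingProb_eq_of_isTargetIndependent` equates Lawler's two-sided law `Ψ_{2/κ}(1 - η)` with
`1 - P[T_y = T_x]` at every cross-ratio `η ∈ (0, 1)` (intermediate value theorem on the
pulled-back parametrisation). For `κ ≥ 8` the right-hand side is `1` (space-filling trace) while
`Ψ < 1`; for `4 < κ < 8` it is Rohde–Schramm's same-side law, and the resulting affine relation
between the two primitives forces `2/κ = 1/3` (`eq_one_third_of_swallowingIntegral_eq_sameSideH`).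
[cite: LawlerSchrammWerner2001, §3] -/
theorem eq_six_of_isSLELaw_of_isTargetIndependent_of_four_lt (hκ : 4 < κ)
    (hQ : ∀ D : DobrushinDomain, IsSLELaw κ D (Q D)) (hT : Q.IsTargetIndependent)
    (D : MarkedDomain 3) : κ = 6 := by
  haveI := isProbabilityMeasure_preWienerMeasure'
  have hTr : HasSLETrace κ := by
    obtain ⟨Γ, ⟨-, ψ, -, hae⟩, -⟩ := hQ (D.chord 0 2 (by decide))
    exact hae.mono fun ω hω ↦ ⟨_, hω.1⟩
  obtain ⟨g, b, hb0, hgc, hg0, hg1, hall⟩ := swallowingProb_eq_of_isTargetIndependent hκ hQ hT D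
  have h01 : D.mark 0 < D.mark 1 := D.strictMono_mark (by decide)
  set a : ℝ := 2 / (κ : ℝ) with ha
  have hκ0 : (0 : ℝ) < κ := by exact_mod_cast lt_trans (by norm_num) hκ
  have hκ4' : (4 : ℝ) < κ := by exact_mod_cast hκ
  have ha0 : 0 < a := div_pos two_pos hκ0
  have ha2 : a < 1 / 2 := by rw [ha, div_lt_div_iff₀ hκ0 (by norm_num)]; linarith
  -- every `η ∈ (0, 1)` is `g t / b`
  have hsweep : ∀ η ∈ Ioo (0 : ℝ) 1, ∃ t ∈ Ioo (D.mark 0) (D.mark 1), g t / b = η := by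
    intro η hη
    have hcont : ContinuousOn (fun t ↦ g t / b) (Icc (D.mark 0) (D.mark 1)) := hgc.div_const b
    have := intermediate_value_Ioo h01.le hcont
    simp only [hg0, hg1, zero_div, div_self hb0] at this
    obtain ⟨t, ht, hteq⟩ := this hη
    exact ⟨t, ht, hteq⟩
  rcases lt_or_ge κ 8 with hκ8 | hκ8
  · -- `4 < κ < 8`: the affine relation between the two primitives
    have hκ8' : (κ : ℝ) < 8 := by exact_mod_cast hκ8
    have ha4 : 1 / 4 < a := by rw [ha, div_lt_div_iff₀ (by norm_num) hκ0]; linarith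
    have hBA : 0 < sameSideHTop a - sameSideH a 1 := sub_pos.2 (sameSideH_one_lt_sameSideHTop ha4 ha2)
    have hI := swallowingIntegral_one_pos ha2
    have hrel : ∀ r ∈ Ioo (0 : ℝ) 1, (swallowingIntegral a 1)⁻¹ * swallowingIntegral a r =
        (sameSideHTop a - sameSideH a 1)⁻¹ * sameSideH a (1 - r)⁻¹ +
          -(sameSideH a 1 / (sameSideHTop a - sameSideH a 1)) := by
      intro r hr
      obtain ⟨t, ht, rfl⟩ := hsweep r hr
      obtain ⟨hηt, hid⟩ := hall t ht
      have hy : 0 < |g t| := abs_pos.2 fun h ↦ by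
        have := hηt.1
        simp [h] at this
      have hyx : |g t| < |b| := by
        have h2 : |g t / b| < 1 := by rw [abs_of_pos hηt.1]; exact hηt.2
        rwa [abs_div, div_lt_one (abs_pos.2 hb0)] at h2
      rw [measureReal_swallowingTime_eq_sameSide hκ hκ8 hy hyx, ← ha] at hid
      have hz : |b| / (|b| - |g t|) = (1 - g t / b)⁻¹ := by
        have : g t / b = |g t| / |b| := by rw [← abs_div, abs_of_pos hηt.1]
        rw [this, inv_eq_one_div, one_sub_div (abs_pos.2 hb0).ne', one_div_div]
      have hr01 : g t / b ∈ Icc (0 : ℝ) 1 := ⟨hηt.1.le, hηt.2.le⟩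
      rw [hz, swallowingProb_eq_swallowingPsi ha0 ha2 ⟨by linarith [hηt.2], by linarith [hηt.1]⟩,
        swallowingPsi_one_sub ha2 hr01, swallowingPsi] at hid
      have hid' : swallowingIntegral a (g t / b) / swallowingIntegral a 1 =
          (sameSideH a (1 - g t / b)⁻¹ - sameSideH a 1) / (sameSideHTop a - sameSideH a 1) := by
        linarith
      rw [inv_mul_eq_div, hid', sub_div, inv_mul_eq_div]
      ring
    have h13 := eq_one_third_of_swallowingIntegral_eq_sameSideH ha2 le_rfl zero_lt_one le_rfl
      (inv_pos.2 hI) hrel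
    rw [ha] at h13
    have h6 : (κ : ℝ) = 6 := by
      field_simp at h13
      linarith
    exact_mod_cast h6
  · -- `κ ≥ 8`: the same-side probability vanishes while `Ψ < 1`
    obtain ⟨t, ht, -⟩ := hsweep (1 / 2) (by norm_num)
    obtain ⟨hηt, hid⟩ := hall t ht
    have hy : 0 < |g t| := abs_pos.2 fun h ↦ by
      have := hηt.1
      simp [h] at this
    have hyx : |g t| < |b| := by
      have h2 : |g t / b| < 1 := by rw [abs_of_pos hηt.1]; exact hηt.2
      rwa [abs_div, div_lt_one (abs_pos.2 hb0)] at h2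
    have hzero := measure_swallowingTime_eq_eq_zero_of_eight_le hκ8 hTr hy hyx
    rw [measureReal_def, hzero, ENNReal.toReal_zero, sub_zero] at hid
    have hlt := (swallowingProb_mem_Ioo ha0 ha2 (r := 1 - g t / b)
      ⟨by linarith [hηt.2], by linarith [hηt.1]⟩).2
    rw [hid] at hlt
    exact absurd hlt (lt_irrefl _)

end Assembly

end Literature.Probability.RandomPlanarGeometry
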